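import Mathlib
import HarnessLib
import Summits.ValiantsHypothesis.ValiantsHypothesis.Theorems.LacunarySymmetroidMatrixDescartesProductPlusOneCrossingSign

/-!
# ValiantsHypothesis / LacunarySymmetroid — crux `MatrixDescartes` (stmt-ValiantsHypothesis-18050, V1),
# LINE (A) «product_plus_one», floor (AB5-2): SIGNS of the row log-Wronskian

Per-row inputs of val-idea-25 g3's AB5/EB2′ in the currency of ✓ `…CrossingSign` (`W(g) = g·X(Xg′)′ − (Xg′)²`,
✓ `logWronskian_fewnomial`):

* `eval_logWronskian_fewnomial` — `W(Σ_l C a_l X^{d_l})(x) = Σ_l Σ_{l'} ((d_l − d_{l'})²/2)·a_l a_{l'}·x^{d_l + d_{l'}}` (every `K`);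
* `theta_monomial` (`X·(C a X^n)′ = C(a n) X^n`), ★ `logWronskian_eval_nonneg_of_pairwise` — a ONE-SIGNED row (`a_l a_{l'} ≥ 0` for all pairs) has `W(x) ≥ 0` at every `x ≥ 0`, every `K`:
  rootless rows NEVER cut a component of `{N > 0}` (they only fill);
* `logWronskian_trinomial` — `K = 3` closed form `W = C((d₀−d₁)² a b) X^{d₀+d₁} + C((d₀−d₂)² a c) X^{d₀+d₂} + C((d₁−d₂)² b c) X^{d₁+d₂}`:
  the sign pattern of `W` is that of the pair products `(ab, ac, bc)` — one-signed `(+,+,+)`, binomial-like one negative term, T5 `(−,−,+)`,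
  T4 `(+,−,−)`, dips `(−,+,−)`; so one-change rows have ONE sign switch of `W` (Descartes; cf. ✓ `logWronskian_nodip_subsingleton`).

HONEST FRAMING: bookkeeping; NOT `OneChangeFloorK3`, not `stub_classRowK3`, not `stub_polyLaw`, not `MatrixDescartes`, not Conjecture B;
`VP ≠ VNP` is NOT proved.  No definitions, no named facts.
-/

set_option linter.dupNamespace false

namespace Summit.ValiantsHypothesis.ValiantsHypothesis.Theorems.LacunarySymmetroidMatrixDescartes

namespace ProductPlusOne

open Polynomial Finset
open scoped BigOperators

/-- **Evaluated log-Wronskian of a fewnomial** (every `K`). [folklore] -/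
theorem eval_logWronskian_fewnomial {K : ℕ} (d : Fin K → ℕ) (a : Fin K → ℝ) (x : ℝ) :
    ((∑ l, C (a l) * X ^ (d l) : ℝ[X]) * (X * derivative (X * derivative (∑ l, C (a l) * X ^ (d l) : ℝ[X])))
        - (X * derivative (∑ l, C (a l) * X ^ (d l) : ℝ[X])) ^ 2).eval x
      = ∑ l, ∑ l', ((d l : ℝ) - d l') ^ 2 / 2 * (a l * a l') * x ^ (d l + d l') := by
  rw [logWronskian_fewnomial]
  simp only [eval_finsetSum, eval_mul, eval_C, eval_pow, eval_X]

/-- ★ **One-signed rows never cut:** if all pair products `a_l a_{l'}` are `≥ 0` then `W(x) ≥ 0` for every `x ≥ 0` (every `K`).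
[this file's theorem] -/
theorem logWronskian_eval_nonneg_of_pairwise {K : ℕ} (d : Fin K → ℕ) (a : Fin K → ℝ) (hs : ∀ l l', 0 ≤ a l * a l')
    {x : ℝ} (hx : 0 ≤ x) :
    0 ≤ ((∑ l, C (a l) * X ^ (d l) : ℝ[X]) * (X * derivative (X * derivative (∑ l, C (a l) * X ^ (d l) : ℝ[X])))
        - (X * derivative (∑ l, C (a l) * X ^ (d l) : ℝ[X])) ^ 2).eval x := by
  rw [eval_logWronskian_fewnomial]
  refine Finset.sum_nonneg fun l _ => Finset.sum_nonneg fun l' _ => ?_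
  exact mul_nonneg (mul_nonneg (div_nonneg (sq_nonneg _) (by norm_num)) (hs l l')) (pow_nonneg hx _)

/-- `θ(C a·X^n) = C(a·n)·X^n` (`θ = X·d/dX`; also for `n = 0`). [folklore] -/
theorem theta_monomial (a : ℝ) (n : ℕ) : (X : ℝ[X]) * derivative (C a * X ^ n) = C (a * n) * X ^ n := by
  rcases Nat.eq_zero_or_pos n with rfl | hn
  · simp
  · obtain ⟨k, rfl⟩ : ∃ k, n = k + 1 := ⟨n - 1, by omega⟩
    rw [derivative_C_mul_X_pow]
    simp only [Nat.add_sub_cancel, map_mul, Nat.cast_add, Nat.cast_one]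
    rw [pow_succ]
    ring

/-- **`K = 3` closed form** of the log-Wronskian of `a X^{d₀} + b X^{d₁} + c X^{d₂}`: three terms carrying the pair products.
[folklore] -/
theorem logWronskian_trinomial (d₀ d₁ d₂ : ℕ) (a b c : ℝ) :
    ((C a * X ^ d₀ + C b * X ^ d₁ + C c * X ^ d₂ : ℝ[X]) * (X * derivative (X * derivative (C a * X ^ d₀ + C b * X ^ d₁ + C c * X ^ d₂ : ℝ[X])))
        - (X * derivative (C a * X ^ d₀ + C b * X ^ d₁ + C c * X ^ d₂ : ℝ[X])) ^ 2)
      = C (((d₀ : ℝ) - d₁) ^ 2 * (a * b)) * X ^ (d₀ + d₁) + C (((d₀ : ℝ) - d₂) ^ 2 * (a * c)) * X ^ (d₀ + d₂)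
        + C (((d₁ : ℝ) - d₂) ^ 2 * (b * c)) * X ^ (d₁ + d₂) := by
  have h1 : (X : ℝ[X]) * derivative (C a * X ^ d₀ + C b * X ^ d₁ + C c * X ^ d₂ : ℝ[X])
      = C (a * d₀) * X ^ d₀ + C (b * d₁) * X ^ d₁ + C (c * d₂) * X ^ d₂ := by
    rw [derivative_add, derivative_add, mul_add, mul_add, theta_monomial, theta_monomial, theta_monomial]
  have h2 : (X : ℝ[X]) * derivative (C (a * d₀) * X ^ d₀ + C (b * d₁) * X ^ d₁ + C (c * d₂) * X ^ d₂ : ℝ[X])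
      = C (a * d₀ * d₀) * X ^ d₀ + C (b * d₁ * d₁) * X ^ d₁ + C (c * d₂ * d₂) * X ^ d₂ := by
    rw [derivative_add, derivative_add, mul_add, mul_add, theta_monomial, theta_monomial, theta_monomial]
  rw [h1, h2]
  simp only [map_mul, map_pow, map_sub, map_natCast]
  ring

end ProductPlusOne

end Summit.ValiantsHypothesis.ValiantsHypothesis.Theorems.LacunarySymmetroidMatrixDescartes
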